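import Mathlib
import Literature.NumberTheory.Irrationality.BrownZudilin2022.CellularZetaFive
import Summits.KontsevichZagierPeriods.Zeta5Search.InvarianceGroup
import HarnessLib

/-!
# The level-1 top-pair cellular integral `I(0,0,1,0,1,1,0,1) = 1` (cell `pub-zeta5`, seat ct-1 g20)

HONEST FRAMING: systematic search; no irrationality claim unless certified.  This file EVALUATES one of
Brown–Zudilin's 5-fold cellular integrals [BrownZudilin2022, Sect. 1, eq. (1)] by elementary calculus:
for `a = (0,0,1,0,1,1,0,1)` (dual coordinates `b(a) = (1; 1,0,0,0,0,0,1)`, the level-1 "top pair 17" of gen-1's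
terminal programme, memo `pub-zeta5-gen-1/D2-TERMINAL-g17.md` §5 / `code/gen1/g17/data/LEVEL1-EXACT.md` Theorem A)
the integrand of (1) is
  `(t₃−t₂)(t₅−t₄)(1−t₅) / ((t₃−t₁)² t₃ (1−t₄)² (t₄−t₂)(t₅−t₂)²)`
on `0 < t₁ < ⋯ < t₅ < 1`, and integrating successively in `t₁` (`∫₀^{t₂} dt₁/(t₃−t₁)² = t₂/(t₃(t₃−t₂))`),
`t₃` (`∫ dt₃/t₃²`), `t₂` (`∫ dt₂/(t₅−t₂)²`), `t₄` (`∫ dt₄/(1−t₄)²`) and `t₅` (`∫₀¹ 1`) gives EXACTLY `1`; every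
intermediate integrand is a rational function and every one-variable integral is `∫ K/(c−t)² dt` over an interval not
containing `c`.  In Lean: Tonelli through `MeasureTheory.lmarginal` (one coordinate peeled at a time, in the order
`0, 2, 1, 3, 4`), each step a `lintegral` of an interval indicator computed by the fundamental theorem of calculus;
the Bochner integral `cellularIntegral` is then the `toReal` of the computed `lintegral` (non-negative integrand).

OUR work (Summit side): the value is not printed in [BrownZudilin2022]; it is the datum `D17` of the cell's wedge-dictionary
programme (`WedgeDictionaryDiagData.explicitPQ_iff_diag2_top`), whose dictionary side is in the companion file
`WedgeDictionaryTopPairDatum`.  The measurability of the simplex is the tree's `InvarianceGroup.measurableSet_openSimplex'`.  Nothing here is about `ζ(5)`, a linear form, a denominator or an exponent.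
-/

noncomputable section

open MeasureTheory Set

namespace Summit.KontsevichZagierPeriods.Zeta5Search.WedgeDictionaryTopPairIntegral

open Literature.NumberTheory.Irrationality.BrownZudilin2022 (integrand cellularIntegral openSimplex b24 b14 b57 b35 b36)
open Summit.KontsevichZagierPeriods.Zeta5Search.InvarianceGroup (measurableSet_openSimplex')

/-! ## 1. One-variable step: `∫_{(a,b)} K/(c−t)² dt = K·(1/(c−b) − 1/(c−a))` for `c ∉ [a,b]` -/

/-- The one-variable integral behind every step: for `K ≥ 0`, `a ≤ b` and `c` outside `[a, b]`,
`∫⁻_{t ∈ (a,b)} K/(c−t)² = K·(1/(c−b) − 1/(c−a))` (as an `ℝ≥0∞`-valued Lebesgue integral; FTC with the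
antiderivative `K/(c−t)`). [folklore] -/
theorem lintegral_div_sq_sub (K a b c : ℝ) (hK : 0 ≤ K) (hab : a ≤ b) (hc : b < c ∨ c < a) :
    ∫⁻ t in Ioo a b, ENNReal.ofReal (K / (c - t) ^ 2) =
      ENNReal.ofReal (K * (1 / (c - b) - 1 / (c - a))) := by
  have hne : ∀ t ∈ uIcc a b, c - t ≠ 0 := by
    intro t ht h0
    rw [uIcc_of_le hab] at ht
    rcases hc with h | h <;> linarith [ht.1, ht.2]
  have hcont : ContinuousOn (fun t : ℝ => K / (c - t) ^ 2) (uIcc a b) := by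
    refine ContinuousOn.div continuousOn_const (by fun_prop) ?_
    intro t ht
    exact pow_ne_zero 2 (hne t ht)
  rw [← ofReal_integral_eq_lintegral_ofReal]
  · congr 1
    rw [← integral_Ioc_eq_integral_Ioo, ← intervalIntegral.integral_of_le hab]
    have hderiv : ∀ t ∈ uIcc a b, HasDerivAt (fun t : ℝ => K / (c - t)) (K / (c - t) ^ 2) t := by
      intro t ht
      have h := (hasDerivAt_const t K).div ((hasDerivAt_id' t).const_sub c) (hne t ht)
      exact h.congr_deriv (by ring)
    rw [intervalIntegral.integral_eq_sub_of_hasDerivAt hderiv hcont.intervalIntegrable]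
    ring
  · rw [uIcc_of_le hab] at hcont
    exact hcont.integrableOn_Icc.mono_set Ioo_subset_Icc_self
  · exact ae_of_all _ (fun t => by positivity)

/-! ## 2. The point, its integrand, and the chain of partially integrated functions -/

/-- The parameter vector `a = (0,0,1,0,1,1,0,1)` (dual coordinates `(1; 1,0,0,0,0,0,1)`: level `b₀ = 1`, top pair `{1,7}`);
a local notation, so that this file declares theorems only. -/
local notation "aTop" => (![0, 0, 1, 0, 1, 1, 0, 1] : Fin 8 → ℤ)

/-- `b₂₄(a) = 1`. [folklore] -/
theorem b24_aTop : b24 aTop = 1 := by decide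
/-- `b₁₄(a) = 0`. [folklore] -/
theorem b14_aTop : b14 aTop = 0 := by decide
/-- `b₅₇(a) = 1`. [folklore] -/
theorem b57_aTop : b57 aTop = 1 := by decide
/-- `b₃₅(a) = 0`. [folklore] -/
theorem b35_aTop : b35 aTop = 0 := by decide
/-- `b₃₆(a) = 1`. [folklore] -/
theorem b36_aTop : b36 aTop = 1 := by decide

/-- The integrand of (1) at `a` as a rational function (coordinates `t 0, …, t 4` for `t₁, …, t₅`):
`(t₃−t₂)(t₅−t₄)(1−t₅)/((t₃−t₁)(1−t₄)(t₅−t₂)) / ((t₃−t₁)t₃(1−t₄)(t₄−t₂)(t₅−t₂))` (local notation). -/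
local notation "fTop" => (fun t : Fin 5 → ℝ =>
  (t 2 - t 1) * (t 4 - t 3) * (1 - t 4) / ((t 2 - t 0) * (1 - t 3) * (t 4 - t 1)) /
    ((t 2 - t 0) * t 2 * (1 - t 3) * (t 3 - t 1) * (t 4 - t 1)))

/-- The integrand of (1) at `a` IS `fTop` (everywhere; all exponents are `0` or `1`). [folklore] -/
theorem integrand_aTop (t : Fin 5 → ℝ) : integrand aTop t = fTop t := by
  unfold integrand
  rw [b24_aTop, b14_aTop, b57_aTop, b35_aTop, b36_aTop]
  simp

/-- `fTop` is measurable. [folklore] -/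
theorem measurable_fTop : Measurable fTop := by
  fun_prop

/-- The extended integrand: `fTop` on the open simplex, `0` outside, valued in `ℝ≥0∞` (local notation). -/
local notation "FTop" => (Set.indicator openSimplex (fun t : Fin 5 → ℝ => ENNReal.ofReal (fTop t)))

/-- `FTop` is measurable. [folklore] -/
theorem measurable_F : Measurable FTop :=
  (ENNReal.measurable_ofReal.comp measurable_fTop).indicator measurableSet_openSimplex'

/-- After the `t₁`-integration: `t₂(t₅−t₄)(1−t₅)/(t₃²(1−t₄)²(t₄−t₂)(t₅−t₂)²)` on `0 < t₂ < t₃ < t₄ < t₅ < 1` (local notation). -/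
local notation "GTop1" => (fun x : Fin 5 → ℝ =>
  ite (0 < x 1 ∧ x 1 < x 2 ∧ x 2 < x 3 ∧ x 3 < x 4 ∧ x 4 < 1)
    (ENNReal.ofReal (x 1 * (x 4 - x 3) * (1 - x 4) / (x 2 ^ 2 * (1 - x 3) ^ 2 * (x 3 - x 1) * (x 4 - x 1) ^ 2)))
    (0 : ENNReal))

/-- After the `t₃`-integration: `(t₅−t₄)(1−t₅)/(t₄(1−t₄)²(t₅−t₂)²)` on `0 < t₂ < t₄ < t₅ < 1` (local notation). -/
local notation "GTop2" => (fun x : Fin 5 → ℝ =>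
  ite (0 < x 1 ∧ x 1 < x 3 ∧ x 3 < x 4 ∧ x 4 < 1)
    (ENNReal.ofReal ((x 4 - x 3) * (1 - x 4) / (x 3 * (1 - x 3) ^ 2 * (x 4 - x 1) ^ 2)))
    (0 : ENNReal))

/-- After the `t₂`-integration: `(1−t₅)/((1−t₄)² t₅)` on `0 < t₄ < t₅ < 1` (local notation). -/
local notation "GTop3" => (fun x : Fin 5 → ℝ =>
  ite (0 < x 3 ∧ x 3 < x 4 ∧ x 4 < 1) (ENNReal.ofReal ((1 - x 4) / ((1 - x 3) ^ 2 * x 4))) (0 : ENNReal))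

/-- After the `t₄`-integration: `1` on `0 < t₅ < 1` (local notation). -/
local notation "GTop4" => (fun x : Fin 5 → ℝ => ite (0 < x 4 ∧ x 4 < 1) (1 : ENNReal) (0 : ENNReal))

/-- `GTop1` is measurable. [folklore] -/
theorem measurable_G1 : Measurable GTop1 := by
  refine Measurable.ite ?_ (by fun_prop) measurable_const
  measurability

/-- `GTop2` is measurable. [folklore] -/
theorem measurable_G2 : Measurable GTop2 := by
  refine Measurable.ite ?_ (by fun_prop) measurable_const
  measurability

/-- `GTop3` is measurable. [folklore] -/
theorem measurable_G3 : Measurable GTop3 := by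
  refine Measurable.ite ?_ (by fun_prop) measurable_const
  measurability

/-- `GTop4` is measurable. [folklore] -/
theorem measurable_G4 : Measurable GTop4 := by
  refine Measurable.ite ?_ measurable_const measurable_const
  measurability

/-! ## 3. The five one-variable integrations -/

/-- Step 0 (`t₁ ∈ (0, t₂)`, kernel `1/(t₃−t₁)²`). [folklore] -/
theorem step0 (x : Fin 5 → ℝ) : ∫⁻ s, FTop (Function.update x 0 s) = GTop1 x := by
  have h10 : (1 : Fin 5) ≠ 0 := by decide
  have h20 : (2 : Fin 5) ≠ 0 := by decide
  have h30 : (3 : Fin 5) ≠ 0 := by decide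
  have h40 : (4 : Fin 5) ≠ 0 := by decide
  by_cases hC : 0 < x 1 ∧ x 1 < x 2 ∧ x 2 < x 3 ∧ x 3 < x 4 ∧ x 4 < 1
  · obtain ⟨h1, h12, h23, h34, h4⟩ := hC
    have d21 : 0 < x 2 - x 1 := by linarith
    have d43 : 0 < x 4 - x 3 := by linarith
    have d4 : 0 < 1 - x 4 := by linarith
    have d2 : 0 < x 2 := by linarith
    have d3 : 0 < 1 - x 3 := by linarith
    have d31 : 0 < x 3 - x 1 := by linarith
    have d41 : 0 < x 4 - x 1 := by linarith
    set K : ℝ := (x 2 - x 1) * (x 4 - x 3) * (1 - x 4) /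
      (x 2 * (1 - x 3) ^ 2 * (x 3 - x 1) * (x 4 - x 1) ^ 2) with hKdef
    have hK : 0 ≤ K := by positivity
    have hfun : (fun s => FTop (Function.update x 0 s)) =
        (Ioo 0 (x 1)).indicator (fun s => ENNReal.ofReal (K / (x 2 - s) ^ 2)) := by
      funext s
      simp only [Set.indicator_apply, openSimplex, Set.mem_setOf_eq, Set.mem_Ioo,
        Function.update_self, Function.update_of_ne h10, Function.update_of_ne h20,
        Function.update_of_ne h30, Function.update_of_ne h40]
      by_cases hs : 0 < s ∧ s < x 1
      · rw [if_pos ⟨hs.1, hs.2, h12, h23, h34, h4⟩, if_pos hs]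
        congr 1
        have hs2 : x 2 - s ≠ 0 := by linarith [hs.2]
        rw [hKdef]
        field_simp
      · rw [if_neg (fun h => hs ⟨h.1, h.2.1⟩), if_neg hs]
    rw [hfun, lintegral_indicator measurableSet_Ioo,
      lintegral_div_sq_sub K 0 (x 1) (x 2) hK h1.le (Or.inl h12)]
    simp only [if_pos (⟨h1, h12, h23, h34, h4⟩ : 0 < x 1 ∧ x 1 < x 2 ∧ x 2 < x 3 ∧ x 3 < x 4 ∧ x 4 < 1)]
    congr 1
    rw [hKdef, sub_zero]
    field_simp
    ring
  · have hfun : (fun s => FTop (Function.update x 0 s)) = fun _ => 0 := by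
      funext s
      simp only [Set.indicator_apply, openSimplex, Set.mem_setOf_eq,
        Function.update_self, Function.update_of_ne h10, Function.update_of_ne h20,
        Function.update_of_ne h30, Function.update_of_ne h40]
      rw [if_neg]
      intro h
      exact hC ⟨h.1.trans h.2.1, h.2.2⟩
    rw [hfun, lintegral_zero]
    simp only [if_neg hC]

/-- Step 1 (`t₃ ∈ (t₂, t₄)`, kernel `1/t₃²`). [folklore] -/
theorem step1 (x : Fin 5 → ℝ) : ∫⁻ s, GTop1 (Function.update x 2 s) = GTop2 x := by
  have h12 : (1 : Fin 5) ≠ 2 := by decide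
  have h32 : (3 : Fin 5) ≠ 2 := by decide
  have h42 : (4 : Fin 5) ≠ 2 := by decide
  by_cases hC : 0 < x 1 ∧ x 1 < x 3 ∧ x 3 < x 4 ∧ x 4 < 1
  · obtain ⟨h1, h13, h34, h4⟩ := hC
    have d43 : 0 < x 4 - x 3 := by linarith
    have d4 : 0 < 1 - x 4 := by linarith
    have d3 : 0 < 1 - x 3 := by linarith
    have d31 : 0 < x 3 - x 1 := by linarith
    have d41 : 0 < x 4 - x 1 := by linarith
    have d3' : 0 < x 3 := by linarith
    set K : ℝ := x 1 * (x 4 - x 3) * (1 - x 4) / ((1 - x 3) ^ 2 * (x 3 - x 1) * (x 4 - x 1) ^ 2) with hKdef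
    have hK : 0 ≤ K := by positivity
    have hfun : (fun s => GTop1 (Function.update x 2 s)) =
        (Ioo (x 1) (x 3)).indicator (fun s => ENNReal.ofReal (K / (0 - s) ^ 2)) := by
      funext s
      simp only [Set.indicator_apply, Set.mem_Ioo,
        Function.update_self, Function.update_of_ne h12, Function.update_of_ne h32, Function.update_of_ne h42]
      by_cases hs : x 1 < s ∧ s < x 3
      · rw [if_pos ⟨h1, hs.1, hs.2, h34, h4⟩, if_pos hs]
        congr 1
        have hs0 : s ≠ 0 := by linarith [hs.1]
        rw [hKdef, zero_sub, neg_sq]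
        field_simp
      · rw [if_neg (fun h => hs ⟨h.2.1, h.2.2.1⟩), if_neg hs]
    rw [hfun, lintegral_indicator measurableSet_Ioo,
      lintegral_div_sq_sub K (x 1) (x 3) 0 hK h13.le (Or.inr h1)]
    simp only [if_pos (⟨h1, h13, h34, h4⟩ : 0 < x 1 ∧ x 1 < x 3 ∧ x 3 < x 4 ∧ x 4 < 1)]
    congr 1
    rw [hKdef, zero_sub, zero_sub]
    have h1' : x 1 ≠ 0 := h1.ne'
    field_simp
    ring
  · have hfun : (fun s => GTop1 (Function.update x 2 s)) = fun _ => 0 := by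
      funext s
      simp only [Function.update_self, Function.update_of_ne h12, Function.update_of_ne h32,
        Function.update_of_ne h42]
      rw [if_neg]
      intro h
      exact hC ⟨h.1, h.2.1.trans h.2.2.1, h.2.2.2⟩
    rw [hfun, lintegral_zero]
    simp only [if_neg hC]

/-- Step 2 (`t₂ ∈ (0, t₄)`, kernel `1/(t₅−t₂)²`). [folklore] -/
theorem step2 (x : Fin 5 → ℝ) : ∫⁻ s, GTop2 (Function.update x 1 s) = GTop3 x := by
  have h31 : (3 : Fin 5) ≠ 1 := by decide
  have h41 : (4 : Fin 5) ≠ 1 := by decide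
  by_cases hC : 0 < x 3 ∧ x 3 < x 4 ∧ x 4 < 1
  · obtain ⟨h3, h34, h4⟩ := hC
    have d43 : 0 < x 4 - x 3 := by linarith
    have d4 : 0 < 1 - x 4 := by linarith
    have d3 : 0 < 1 - x 3 := by linarith
    have d4' : 0 < x 4 := by linarith
    set K : ℝ := (x 4 - x 3) * (1 - x 4) / (x 3 * (1 - x 3) ^ 2) with hKdef
    have hK : 0 ≤ K := by positivity
    have hfun : (fun s => GTop2 (Function.update x 1 s)) =
        (Ioo 0 (x 3)).indicator (fun s => ENNReal.ofReal (K / (x 4 - s) ^ 2)) := by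
      funext s
      simp only [Set.indicator_apply, Set.mem_Ioo,
        Function.update_self, Function.update_of_ne h31, Function.update_of_ne h41]
      by_cases hs : 0 < s ∧ s < x 3
      · rw [if_pos ⟨hs.1, hs.2, h34, h4⟩, if_pos hs]
        congr 1
        have hs4 : x 4 - s ≠ 0 := by linarith [hs.2]
        rw [hKdef]
        field_simp
      · rw [if_neg (fun h => hs ⟨h.1, h.2.1⟩), if_neg hs]
    rw [hfun, lintegral_indicator measurableSet_Ioo,
      lintegral_div_sq_sub K 0 (x 3) (x 4) hK h3.le (Or.inl h34)]
    simp only [if_pos (⟨h3, h34, h4⟩ : 0 < x 3 ∧ x 3 < x 4 ∧ x 4 < 1)]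
    congr 1
    rw [hKdef, sub_zero]
    field_simp
    ring
  · have hfun : (fun s => GTop2 (Function.update x 1 s)) = fun _ => 0 := by
      funext s
      simp only [Function.update_self, Function.update_of_ne h31, Function.update_of_ne h41]
      rw [if_neg]
      intro h
      exact hC ⟨h.1.trans h.2.1, h.2.2⟩
    rw [hfun, lintegral_zero]
    simp only [if_neg hC]

/-- Step 3 (`t₄ ∈ (0, t₅)`, kernel `1/(1−t₄)²`). [folklore] -/
theorem step3 (x : Fin 5 → ℝ) : ∫⁻ s, GTop3 (Function.update x 3 s) = GTop4 x := by
  have h43 : (4 : Fin 5) ≠ 3 := by decide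
  by_cases hC : 0 < x 4 ∧ x 4 < 1
  · obtain ⟨h4', h4⟩ := hC
    have d4 : 0 < 1 - x 4 := by linarith
    set K : ℝ := (1 - x 4) / x 4 with hKdef
    have hK : 0 ≤ K := by positivity
    have hfun : (fun s => GTop3 (Function.update x 3 s)) =
        (Ioo 0 (x 4)).indicator (fun s => ENNReal.ofReal (K / (1 - s) ^ 2)) := by
      funext s
      simp only [Set.indicator_apply, Set.mem_Ioo, Function.update_self, Function.update_of_ne h43]
      by_cases hs : 0 < s ∧ s < x 4
      · rw [if_pos ⟨hs.1, hs.2, h4⟩, if_pos hs]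
        congr 1
        have hs1 : 1 - s ≠ 0 := by linarith [hs.2]
        rw [hKdef]
        field_simp
      · rw [if_neg (fun h => hs ⟨h.1, h.2.1⟩), if_neg hs]
    rw [hfun, lintegral_indicator measurableSet_Ioo,
      lintegral_div_sq_sub K 0 (x 4) 1 hK h4'.le (Or.inl h4)]
    simp only [if_pos (⟨h4', h4⟩ : 0 < x 4 ∧ x 4 < 1)]
    rw [← ENNReal.ofReal_one]
    congr 1
    rw [hKdef, sub_zero]
    field_simp
    ring
  · have hfun : (fun s => GTop3 (Function.update x 3 s)) = fun _ => 0 := by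
      funext s
      simp only [Function.update_self, Function.update_of_ne h43]
      rw [if_neg]
      intro h
      exact hC ⟨h.1.trans h.2.1, h.2.2⟩
    rw [hfun, lintegral_zero]
    simp only [if_neg hC]

/-- Step 4 (`t₅ ∈ (0, 1)`, constant `1`). [folklore] -/
theorem step4 (x : Fin 5 → ℝ) : ∫⁻ s, GTop4 (Function.update x 4 s) = 1 := by
  have hfun : (fun s => GTop4 (Function.update x 4 s)) = (Ioo (0 : ℝ) 1).indicator 1 := by
    funext s
    simp only [Set.indicator_apply, Set.mem_Ioo, Function.update_self, Pi.one_apply]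
  rw [hfun, lintegral_indicator measurableSet_Ioo]
  simp

/-! ## 4. Assembly: Tonelli through `lmarginal`, and the value of the cellular integral -/

/-- One peeling step of the iterated integral. [folklore] -/
theorem peel {s : Finset (Fin 5)} {i : Fin 5} (hi : i ∉ s) {f g : (Fin 5 → ℝ) → ENNReal} (hf : Measurable f)
    (h : ∀ x, ∫⁻ t, f (Function.update x i t) = g x) (x : Fin 5 → ℝ) :
    lmarginal (fun _ : Fin 5 => (volume : Measure ℝ)) (insert i s) f x =
      lmarginal (fun _ : Fin 5 => (volume : Measure ℝ)) s g x := by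
  rw [lmarginal_insert' f hf hi]
  have e : (fun y => ∫⁻ t, f (Function.update y i t) ∂((fun _ : Fin 5 => (volume : Measure ℝ)) i)) = g :=
    funext h
  rw [e]

/-- `∫ FTop = 1` over `ℝ⁵` (Tonelli, coordinates integrated in the order `t₁, t₃, t₂, t₄, t₅`). [folklore] -/
theorem lintegral_F : ∫⁻ t, FTop t = 1 := by
  rw [MeasureTheory.volume_pi, lintegral_eq_lmarginal_univ (fun _ : Fin 5 => (0 : ℝ))]
  rw [show (Finset.univ : Finset (Fin 5)) = insert 0 {1, 2, 3, 4} from by decide,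
    peel (by decide) measurable_F step0,
    show ({1, 2, 3, 4} : Finset (Fin 5)) = insert 2 {1, 3, 4} from by decide,
    peel (by decide) measurable_G1 step1,
    peel (by decide) measurable_G2 step2,
    peel (by decide) measurable_G3 step3, lmarginal_singleton]
  exact step4 _

/-- `fTop` is non-negative on the open simplex. [folklore] -/
theorem fTop_nonneg {t : Fin 5 → ℝ} (ht : t ∈ openSimplex) : 0 ≤ fTop t := by
  obtain ⟨h0, h01, h12, h23, h34, h4⟩ := ht
  have d21 : 0 < t 2 - t 1 := by linarith
  have d43 : 0 < t 4 - t 3 := by linarith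
  have d4 : 0 < 1 - t 4 := by linarith
  have d20 : 0 < t 2 - t 0 := by linarith
  have d3 : 0 < 1 - t 3 := by linarith
  have d41 : 0 < t 4 - t 1 := by linarith
  have d2 : 0 < t 2 := by linarith
  have d31 : 0 < t 3 - t 1 := by linarith
  beta_reduce
  positivity

/-- **`I(0,0,1,0,1,1,0,1) = 1`** — the 5-fold cellular integral (1) of Brown–Zudilin at `a = (0,0,1,0,1,1,0,1)`
equals `1` exactly (elementary calculus; gen-1 g17 `LEVEL1-EXACT.md` Theorem A, "pair 17"). [folklore] -/
theorem cellularIntegral_top17 : cellularIntegral ![0, 0, 1, 0, 1, 1, 0, 1] = 1 := by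
  show cellularIntegral aTop = 1
  unfold cellularIntegral
  simp_rw [integrand_aTop]
  rw [integral_eq_lintegral_of_nonneg_ae (ae_restrict_of_forall_mem measurableSet_openSimplex' fun t ht => fTop_nonneg ht)
    measurable_fTop.aestronglyMeasurable, ← lintegral_indicator measurableSet_openSimplex']
  rw [show (∫⁻ t, openSimplex.indicator (fun t => ENNReal.ofReal (fTop t)) t) = 1 from lintegral_F]
  simp

end Summit.KontsevichZagierPeriods.Zeta5Search.WedgeDictionaryTopPairIntegral

end
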